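import Summits.ResolutionOfSingularities.ResolutionOfSingularities.Theorems.HilbertSamuelEliminationSigmaMaxModificationsCorridor3WLadderIsoTailsSeparableTensorReduced
import Mathlib.RingTheory.TensorProduct.Pi
import Mathlib.RingTheory.Ideal.MinimalPrime.Noetherian
import Mathlib.RingTheory.Localization.FractionRing
import Mathlib.RingTheory.Nilpotent.Lemmas
import HarnessLib

/-!
# [OURS · L1 W4.2] K2-sep ROUTE A, brick (α′): **a REDUCED noetherian `k`-algebra stays reduced after a SEPARABLE algebraic ground-field
# extension — `IsReduced (A ⊗ₖ K)`** (EGA IV₂ (4.6.1); `A ↪ ∏_𝔭 Frac(A/𝔭)` over the minimal primes, `K` flat over `k`, and the field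
# case `isReduced_tensorProduct_of_isSeparable`)
# (crux `SigmaMaxModifications` stmt-ResolutionOfSingularities-18506 / conjunct stmt-…-19249; line `w_ladder_rows` v8.5, registered stub
# `stub_isoSepRecurrent`; res-L1-w42-plan-1 WORD 2026-08-27T16:25:47Z; design `L/res-L1-w42-stub-2/k2sep/K2SEP-DESIGN.md` brick (α))

Prover res-L1-w42-stub-2 (gen 5). Helper file `--supports stmt-ResolutionOfSingularities-19249 --as helper`; no definitions, no named fact. OURS
(cell res-hironaka, slot W4.2); NOT statements of [Hironaka2017] nor of [CossartJannsenSaito2020]. AI-written; AI review is weaker than expert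
review. WHY: the stages `X_n ×_k K` of the base-changed tower must be REDUCED (maximal origins are reduced); affine-locally this is the
present statement for `A = Γ(U, 𝒪)`.

* `injective_toPiFractionRing` — for `A` reduced noetherian, `A → ∏_{𝔭 minimal} Frac(A/𝔭)` is injective.
* **`isReduced_tensorProduct_left_of_isReduced`** (`K ⊗ₖ A`) and **`isReduced_tensorProduct_of_isReduced`** (`A ⊗ₖ K`) — reduced for
  `K/k` separable algebraic of any degree.

[OURS · L1 W4.2; AI-written] [cite: GrothendieckDieudonne1965, Prop. (4.6.1)]
-/

set_option linter.dupNamespace false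

noncomputable section

open scoped TensorProduct

namespace Summit.ResolutionOfSingularities.ResolutionOfSingularities.Theorems.SigmaMaxModificationsCorridor3.IsoTailsHS

universe u v w

section Reduced

variable (k : Type u) (A : Type v) [Field k] [CommRing A] [Algebra k A] [IsNoetherianRing A] [IsReduced A]

omit [Algebra k A] [IsNoetherianRing A] in
/-- For a reduced ring, an element lying in every minimal prime is zero. [folklore] -/
theorem eq_zero_of_forall_mem_minimalPrimes {a : A} (ha : ∀ 𝔭 ∈ minimalPrimes A, a ∈ 𝔭) : a = 0 := by
  have h : a ∈ sInf (minimalPrimes A) := by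
    rw [Submodule.mem_sInf]; exact ha
  have h2 : a ∈ nilradical A := by
    rw [nilradical, ← Ideal.sInf_minimalPrimes]; exact h
  rwa [nilradical_eq_zero, Ideal.zero_eq_bot, Ideal.mem_bot] at h2

/-- **`A ↪ ∏_{𝔭 minimal} Frac(A/𝔭)`** for `A` reduced noetherian (the kernel is the intersection of the minimal primes, i.e. the nilradical).
[folklore] -/
theorem injective_toPiFractionRing :
    Function.Injective (AlgHom.pi (R := k) (A := fun 𝔭 : (minimalPrimes.finite_of_isNoetherianRing A).toFinset => FractionRing (A ⧸ 𝔭.1))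
      fun 𝔭 => (IsScalarTower.toAlgHom k (A ⧸ 𝔭.1) (FractionRing (A ⧸ 𝔭.1))).comp (Ideal.Quotient.mkₐ k 𝔭.1)) := by
  rw [injective_iff_map_eq_zero]
  intro a ha
  refine eq_zero_of_forall_mem_minimalPrimes A fun 𝔭 h𝔭 => ?_
  haveI : 𝔭.IsPrime := h𝔭.1.1
  have h := congr_fun ha ⟨𝔭, (Set.Finite.mem_toFinset _).mpr h𝔭⟩
  simp only [AlgHom.pi_apply, AlgHom.coe_comp, Function.comp_apply, Ideal.Quotient.mkₐ_eq_mk, IsScalarTower.coe_toAlgHom',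
    Pi.zero_apply] at h
  have h' : (Ideal.Quotient.mk 𝔭 a : A ⧸ 𝔭) = 0 :=
    (IsFractionRing.injective (A ⧸ 𝔭) (FractionRing (A ⧸ 𝔭))) (by rw [h, map_zero])
  exact Ideal.Quotient.eq_zero_iff_mem.mp h'

/-- **`K ⊗ₖ A` is reduced** for `A` reduced noetherian and `K/k` separable algebraic of any degree: `K ⊗ₖ A ↪ K ⊗ₖ ∏ Frac(A/𝔭) ≅
∏ (K ⊗ₖ Frac(A/𝔭))` (`K` flat over `k`; finite product), each factor reduced by the field case. [cite: GrothendieckDieudonne1965, Prop. (4.6.1)] -/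
theorem isReduced_tensorProduct_left_of_isReduced (K : Type u) [Field K] [Algebra k K] [Algebra.IsSeparable k K] :
    IsReduced (K ⊗[k] A) := by
  classical
  set ι := (minimalPrimes.finite_of_isNoetherianRing A).toFinset with hι
  let F : ι → Type v := fun 𝔭 => FractionRing (A ⧸ 𝔭.1)
  haveI : ∀ 𝔭 : ι, (𝔭.1).IsPrime := fun 𝔭 => (((Set.Finite.mem_toFinset _).mp 𝔭.2)).1.1
  let φ : A →ₐ[k] (∀ 𝔭 : ι, F 𝔭) :=
    AlgHom.pi (R := k) (A := F) fun 𝔭 => (IsScalarTower.toAlgHom k (A ⧸ 𝔭.1) (F 𝔭)).comp (Ideal.Quotient.mkₐ k 𝔭.1)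
  have hφ : Function.Injective φ := injective_toPiFractionRing k A
  -- base change of the embedding stays injective (`K` flat over `k`)
  let ψ := Algebra.TensorProduct.map (AlgHom.id k K) φ
  have hψ : Function.Injective ψ := by
    have h : Function.Injective ((φ.toLinearMap).lTensor K) :=
      Module.Flat.lTensor_preserves_injective_linearMap (M := K) φ.toLinearMap hφ
    intro a b hab
    exact h hab
  -- the target is a finite product of reduced rings
  haveI : ∀ 𝔭 : ι, IsReduced (K ⊗[k] F 𝔭) := fun 𝔭 => isReduced_tensorProduct_of_isSeparable k K (F 𝔭)
  let e := Algebra.TensorProduct.piRight k k K F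
  haveI : IsReduced (K ⊗[k] ∀ 𝔭 : ι, F 𝔭) := isReduced_of_injective e.toRingEquiv e.injective
  exact isReduced_of_injective ψ hψ

/-- **`A ⊗ₖ K` is reduced** for `A` reduced noetherian and `K/k` separable algebraic of any degree (EGA IV₂ (4.6.1)).
[cite: GrothendieckDieudonne1965, Prop. (4.6.1)] -/
theorem isReduced_tensorProduct_of_isReduced (K : Type u) [Field K] [Algebra k K] [Algebra.IsSeparable k K] :
    IsReduced (A ⊗[k] K) := by
  haveI := isReduced_tensorProduct_left_of_isReduced k A K
  exact isReduced_of_injective (Algebra.TensorProduct.comm k A K).toRingEquiv (Algebra.TensorProduct.comm k A K).injective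

end Reduced

end Summit.ResolutionOfSingularities.ResolutionOfSingularities.Theorems.SigmaMaxModificationsCorridor3.IsoTailsHS

end
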